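import Summits.Parity.GeneralizedHardyLittlewood.Theorems.GreenTaoLevelTwoMNTwoAlmostLinear
import Summits.Parity.GeneralizedHardyLittlewood.Theorems.GreenTaoLevelTwoMNTwoRotationBohrDivisible

/-!
# Route `GreenTaoLevelTwo`, crux `MNTwo` (stmt-Parity-21276), line `birth`, stub `stub_mnVertical`:
# orthogonality to almost linear phases on rotation Bohr sets (GT 2008b Prop. 15)

Block V2 of the `stub_mnVertical` census, COMPLETE (B. Green, T. Tao, *Quadratic uniformity of the
Möbius function*, Ann. Inst. Fourier 58 (2008) = arXiv:math/0606087, §6 Proposition 15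
"Orthogonality to almost linear phases on Bohr sets": for a `1`-step nilsequence with rotation
`g = α ∈ ℝᵏ`, "norm" `‖n‖_g = maxᵢ ‖nαᵢ‖_{ℝ/ℤ} + |n|/N`, Bohr sets `B_g(0,κ)`, a weight `ψ` supported
in `(N,2N]`, an integer `q ≥ 1` and a phase `φ` with
`‖φ(x+h₁+h₂) − φ(x+h₁) − φ(x+h₂) + φ(x)‖_{ℝ/ℤ} ≪ ε` for the four points in the region `S` and
`q ∣ h₁, h₂`: "`|𝔼_{N<n≤2N} μ(n)ψ(n)e(−φ(n))| ≪_{A,G/Γ} κ^{-O_{G/Γ}(1)} q³ log^{-A} N + (ε + κ)𝔼|ψ|`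
… From Lemma 14 (a) and (c) we have `#{h ∈ B_g(0,κ) : q ∣ h} ≫ q⁻¹ p κ^C`").  This file specialises
the abstract form `…MNTwoAlmostLinear.norm_sum_moebius_almost_linear_le` to the shift set
`H = {h ∈ B_α(0,κ) : q ∣ h}` (vocabulary of `…MNTwoRotationBohrSize`), whose density
`δ = (κ/16)^{k+1}/(64·38ᵏ·q)` comes from Lemma 14 (a),(c) (`card_rotationBohr_ge`,
`card_rotationBohr_dvd_ge`); the Lipschitz hypothesis of the paper is kept in the flexible form
`|ψ(n+h₁+h₂) − ψ(n)| ≤ w(n)` (`h₁, h₂ ∈ H`; for `ψ` `L`-Lipschitz in `‖·‖_g` take `w = 2Lκ` on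
`supp ψ + H + H` and `0` elsewhere).  Def-free; constant ineffective (Siegel).

* `norm_sum_moebius_almost_linear_bohr_le` — **Prop. 15**: for every `k`, `A > 0` there is `C ≥ 0`
  with `‖Σ_{N<n≤2N} μ(n)ψ(n)e(−φ(n))‖ ≤ C q²/κ^{k+1} · N/log^A N + 6πε Σψ + Σ_{(N,2N]} w`.

References: [GreenTao2008QuadraticMobius] arXiv:math/0606087 §6, Proposition 15, Lemma 14.
-/

noncomputable section

open Finset Real ArithmeticFunction
open scoped ArithmeticFunction.Moebius

namespace Summit.Parity.GeneralizedHardyLittlewood.GreenTaoLevelTwoMNTwoOrthoProg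

open Summit.Parity.GeneralizedHardyLittlewood.GreenTaoLevelTwoMNTwoAlmostLinear
  (norm_sum_moebius_almost_linear_le)
open Summit.Parity.GeneralizedHardyLittlewood.GreenTaoLevelTwoMNTwoRotationBohrSize
  (card_rotationBohr_ge)
open Summit.Parity.GeneralizedHardyLittlewood.GreenTaoLevelTwoMNTwoRotationBohrDivisible
  (card_rotationBohr_dvd_ge)

/-- **Orthogonality to almost linear phases on Bohr sets (GT 2008b Prop. 15).**  For every `k` and
`A > 0` there is `C ≥ 0` such that for all `N ≥ 2`, rotations `α ∈ ℝᵏ`, `q ≥ 1`, radii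
`0 < κ ≤ 1/2`, weights `0 ≤ ψ ≤ 1` supported in `(N,2N]` with shift bound
`|ψ(n+h₁+h₂) − ψ(n)| ≤ w(n)` for `h₁, h₂ ∈ H := {h ∈ B_α(0,κ) : q ∣ h}`
(`B_α(0,κ) = {|h| < N : maxᵢ‖hαᵢ‖ + |h|/N < κ}`), regions `S ⊇ supp ψ + H + H`, and phases
`φ : ℤ → ℝ/ℤ` with `‖φ(x+h₁+h₂) − φ(x+h₁) − φ(x+h₂) + φ(x)‖ ≤ ε` whenever the four points lie in `S`
and `q ∣ h₁, h₂`: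
`‖Σ_{N<n≤2N} μ(n)ψ(n)e(−φ(n))‖ ≤ C q²/κ^{k+1} · N/log^A N + 6πε Σ_{(N,2N]} ψ + Σ_{(N,2N]} w`.
[cite: GreenTao2008QuadraticMobius, Proposition 15] -/
theorem norm_sum_moebius_almost_linear_bohr_le (k : ℕ) {A : ℝ} (hA : 0 < A) :
    ∃ C : ℝ, 0 ≤ C ∧ ∀ N : ℕ, 2 ≤ N → ∀ (α : Fin k → ℝ) (q : ℕ), 1 ≤ q → ∀ κ : ℝ, 0 < κ →
      κ ≤ 1 / 2 → ∀ (ψ w : ℤ → ℝ) (φ : ℤ → UnitAddCircle) (S : Set ℤ) (ε : ℝ),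
      (∀ n, 0 ≤ ψ n) → (∀ n, ψ n ≤ 1) → (∀ n, ψ n ≠ 0 → (N : ℤ) < n ∧ n ≤ 2 * N) →
      (∀ n, 0 ≤ w n) →
      (∀ n h₁ h₂ : ℤ,
        (((∀ i, ‖(((h₁ : ℝ) * α i : ℝ) : AddCircle (1 : ℝ))‖ + |(h₁ : ℝ)| / N < κ) ∧
            |(h₁ : ℝ)| / N < κ) ∧ (q : ℤ) ∣ h₁) →
        (((∀ i, ‖(((h₂ : ℝ) * α i : ℝ) : AddCircle (1 : ℝ))‖ + |(h₂ : ℝ)| / N < κ) ∧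
            |(h₂ : ℝ)| / N < κ) ∧ (q : ℤ) ∣ h₂) →
        |ψ (n + h₁ + h₂) - ψ n| ≤ w n) →
      (∀ n h₁ h₂ : ℤ, ψ n ≠ 0 →
        (((∀ i, ‖(((h₁ : ℝ) * α i : ℝ) : AddCircle (1 : ℝ))‖ + |(h₁ : ℝ)| / N < κ) ∧
            |(h₁ : ℝ)| / N < κ) ∧ (q : ℤ) ∣ h₁) →
        (((∀ i, ‖(((h₂ : ℝ) * α i : ℝ) : AddCircle (1 : ℝ))‖ + |(h₂ : ℝ)| / N < κ) ∧
            |(h₂ : ℝ)| / N < κ) ∧ (q : ℤ) ∣ h₂) →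
        n + h₁ + h₂ ∈ S) →
      (∀ x h₁ h₂ : ℤ, x ∈ S → x + h₁ ∈ S → x + h₂ ∈ S → x + h₁ + h₂ ∈ S →
        (q : ℤ) ∣ h₁ → (q : ℤ) ∣ h₂ → ‖φ (x + h₁ + h₂) - φ (x + h₁) - φ (x + h₂) + φ x‖ ≤ ε) →
      ‖∑ n ∈ Ioc N (2 * N),
          ((μ n : ℝ) : ℂ) * ((ψ n : ℝ) : ℂ) * ((AddCircle.toCircle (-φ n) : Circle) : ℂ)‖ ≤
        C * q ^ 2 / κ ^ (k + 1) * N / Real.log N ^ A +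
          6 * Real.pi * ε * ∑ n ∈ Ioc N (2 * N), ψ n + ∑ n ∈ Ioc N (2 * N), w n := by
  obtain ⟨C₁, hC₁0, hC₁⟩ := norm_sum_moebius_almost_linear_le hA
  refine ⟨C₁ * (64 * 38 ^ k * 16 ^ (k + 1)), by positivity, ?_⟩
  intro N hN α q hq κ hκ hκ2 ψ w φ S ε hψ0 hψ1 hsupp hw0 hw hS hlin
  classical
  have hN1 : 1 ≤ N := by omega
  have hNpos : (0 : ℝ) < N := by exact_mod_cast (by omega : 0 < N)
  have hlog : 0 < Real.log N := Real.log_pos (by exact_mod_cast (by omega : 1 < N))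
  have hLA : 0 < Real.log N ^ A := Real.rpow_pos_of_pos hlog A
  have hqpos : (0 : ℝ) < q := by exact_mod_cast (by omega : 0 < q)
  -- the shift set `H = {h ∈ B_α(0,κ) : q ∣ h}` and the Bohr set `B = B_α(0,κ)`
  set H := (Finset.Ioo (-(N : ℤ)) N).filter fun h : ℤ =>
    ((∀ i, ‖(((h : ℝ) * α i : ℝ) : AddCircle (1 : ℝ))‖ + |(h : ℝ)| / N < κ) ∧ |(h : ℝ)| / N < κ) ∧
      (q : ℤ) ∣ h with hH
  set B := (Finset.Ioo (-(N : ℤ)) N).filter fun h : ℤ =>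
    (∀ i, ‖(((h : ℝ) * α i : ℝ) : AddCircle (1 : ℝ))‖ + |(h : ℝ)| / N < κ) ∧ |(h : ℝ)| / N < κ
    with hB
  have hmemH : ∀ h ∈ H, (((∀ i, ‖(((h : ℝ) * α i : ℝ) : AddCircle (1 : ℝ))‖ + |(h : ℝ)| / N < κ) ∧
      |(h : ℝ)| / N < κ) ∧ (q : ℤ) ∣ h) ∧ |h| ≤ N := by
    intro h hh
    rw [hH, mem_filter, mem_Ioo] at hh
    exact ⟨hh.2, abs_le.2 ⟨by linarith [hh.1.1], by linarith [hh.1.2]⟩⟩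
  have h0H : (0 : ℤ) ∈ H := by
    rw [hH, mem_filter, mem_Ioo]
    refine ⟨⟨by omega, by omega⟩, ⟨fun i => ?_, by simp [hκ]⟩, dvd_zero _⟩
    simp [hκ]
  have hHN : ∀ h ∈ H, |h| ≤ N ∧ (q : ℤ) ∣ h := fun h hh => ⟨(hmemH h hh).2, (hmemH h hh).1.2⟩
  -- density of `H` from Lemma 14 (a),(c)
  set δ : ℝ := (κ / 16) ^ (k + 1) / (64 * 38 ^ k * q) with hδ
  have hδpos : 0 < δ := by positivity
  have hcardB : (κ / 16) ^ (k + 1) * N / 2 ≤ #B :=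
    card_rotationBohr_ge k hN1 α hκ (by linarith)
  have hcardBH : (#B : ℝ) ≤ 32 * 38 ^ k * q * #H := card_rotationBohr_dvd_ge k hN1 α hκ hκ2 hq
  have hδH : δ * N ≤ #H := by
    rw [hδ]
    have h64 : (0 : ℝ) < 64 * 38 ^ k * q := by positivity
    rw [div_mul_eq_mul_div, div_le_iff₀ h64]
    nlinarith
  -- the abstract Prop. 15
  have main := hC₁ N hN q hq H δ hδpos hδH h0H hHN ψ w φ S ε hψ0 hψ1 hsupp hw0
    (fun n h₁ hh₁ h₂ hh₂ => hw n h₁ h₂ (hmemH h₁ hh₁).1 (hmemH h₂ hh₂).1)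
    (fun n hn h₁ hh₁ h₂ hh₂ => hS n h₁ h₂ hn (hmemH h₁ hh₁).1 (hmemH h₂ hh₂).1) hlin
  refine main.trans ?_
  -- compare the main terms: `q/√δ ≤ q/δ = 64·38ᵏ·16^{k+1} q²/κ^{k+1}`
  have hδle1 : δ ≤ 1 := by
    rw [hδ, div_le_one (by positivity)]
    have h1 : (κ / 16) ^ (k + 1) ≤ 1 := pow_le_one₀ (by positivity) (by linarith)
    have h2 : (1 : ℝ) ≤ 64 * 38 ^ k * q := by
      have : (1 : ℝ) ≤ 38 ^ k := one_le_pow₀ (by norm_num)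
      have : (1 : ℝ) ≤ q := by exact_mod_cast hq
      nlinarith
    linarith
  have hsqrt : δ ≤ Real.sqrt δ := by
    have := Real.sqrt_le_sqrt hδle1
    rw [Real.sqrt_one] at this
    calc δ = Real.sqrt δ * Real.sqrt δ := (Real.mul_self_sqrt hδpos.le).symm
      _ ≤ Real.sqrt δ * 1 := mul_le_mul_of_nonneg_left this (Real.sqrt_nonneg _)
      _ = Real.sqrt δ := mul_one _
  have hkey : C₁ * q / Real.sqrt δ ≤ C₁ * (64 * 38 ^ k * 16 ^ (k + 1)) * q ^ 2 / κ ^ (k + 1) := by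
    have e : C₁ * (64 * 38 ^ k * 16 ^ (k + 1)) * q ^ 2 / κ ^ (k + 1) = C₁ * q / δ := by
      rw [hδ]
      have hκk : κ ^ (k + 1) ≠ 0 := pow_ne_zero _ hκ.ne'
      field_simp
      rw [div_pow]
      field_simp
    rw [e]
    exact div_le_div_of_nonneg_left (by positivity) hδpos hsqrt
  have hmono : C₁ * q / Real.sqrt δ * N / Real.log N ^ A ≤
      C₁ * (64 * 38 ^ k * 16 ^ (k + 1)) * q ^ 2 / κ ^ (k + 1) * N / Real.log N ^ A := by
    rw [div_le_div_iff_of_pos_right hLA]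
    exact mul_le_mul_of_nonneg_right hkey hNpos.le
  linarith

end Summit.Parity.GeneralizedHardyLittlewood.GreenTaoLevelTwoMNTwoOrthoProg
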